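import Summits.AtomisticToContinuum.BoseEinsteinCondensation.Theses.BECPhaseQuadratureSumRule

/-!
# AtomisticToContinuum / BoseEinsteinCondensation — route `BECPhaseQuadratureSumRule`, assembly

Settles the assembly item `stmt-AtomisticToContinuum-12629` of route
`route-AtomisticToContinuum-BECPhaseQuadratureSumRule`: the implication
`SmoothPeriodicBEC → NonCondensateRemainders → CondensateNumberConcentration →
LongWaveStructureBound → BoundaryTransferWeak → ScatteringLengthTransfer → CurrentSumRule →
MinimiserRegularity → NearMinimiserStability → CouplingContinuity → SumRuleChainGlue →
SmoothPartner → BoseEinsteinCondensation`.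

The hypotheses of `Assembly` are, verbatim and in the same order, the first twelve hypotheses of
the route's deciding theorem `closes` (which carries `Assembly` itself as a thirteenth, unused
hypothesis), so the assembly is that composition spelled out once more: fix a repulsive
finite-range `w`; `SmoothPartner` supplies a bounded smooth-class `v` with the same scattering
length; `SumRuleChainGlue` fed with `MinimiserRegularity`, `CouplingContinuity`,
`NearMinimiserStability`, `CurrentSumRule`, `LongWaveStructureBound`, `NonCondensateRemainders`
and `CondensateNumberConcentration` yields `SmoothPeriodicBEC`, whose instance at `v` is exactly
the hypothesis of `BoundaryTransferWeak v`, giving small-density ground-state BEC for `v`;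
`ScatteringLengthTransfer v w` carries it to `w`, which is the body of the sub-problem statement
`BoseEinsteinCondensation`. Pure logic; no analytic content lives here (the hypothesis
`SmoothPeriodicBEC` is not even needed, being re-derived from the glue).
-/

namespace Summit.AtomisticToContinuum.BoseEinsteinCondensation.Theorems

/-- Settles `stmt-AtomisticToContinuum-12629` (exact signature): the assembly of route
`BECPhaseQuadratureSumRule`, i.e. its twelve items imply the sub-problem statement
`BoseEinsteinCondensation`. Proof: for a repulsive finite-range `w`, take the smooth partner `v`
of `SmoothPartner`; `ScatteringLengthTransfer v w` applied to the ground-state BEC for `v` that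
`BoundaryTransferWeak v` produces from the smooth-class periodic BEC delivered by
`SumRuleChainGlue`. [folklore] -/
theorem becPhaseQuadratureSumRule_assembly_proof :
    Summit.AtomisticToContinuum.BoseEinsteinCondensation.Theses.BECPhaseQuadratureSumRule.Assembly := by
  unfold Theses.BECPhaseQuadratureSumRule.Assembly
  intro _h0 h2 h3 h4 hB hT hS hM hN hC hG hP w hw
  obtain ⟨v, hv, hfin, hC2, hedge, hbdd, ha⟩ := hP w hw
  exact hT v w hv hw hbdd ha (hB v hv (hG hM hC hN hS h4 h2 h3 v hv hfin hC2 hedge))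

end Summit.AtomisticToContinuum.BoseEinsteinCondensation.Theorems
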